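import Summits.HodgeConjecture.HodgeConjecture.Theses.HeckePrymWeil
import Literature.AlgebraicGeometry.Motives.AbelianVarietyProduct
import Literature.AlgebraicGeometry.Motives.AbelianVarietyProductDimProofs
import Literature.AlgebraicGeometry.Motives.HyperbolicWeilType
import Literature.AlgebraicGeometry.Motives.HyperbolicWeilTypeProduct
import Summits.HodgeConjecture.HodgeConjecture.Theorems.HeckePrymWeilWeilSixfoldsSqrtMinus7WeilSignatureOf
import Summits.HodgeConjecture.HodgeConjecture.Theorems.HeckePrymWeilWeilSixfoldsSqrtMinus7AimedPartnerOfParts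
import Summits.HodgeConjecture.HodgeConjecture.Theorems.HeckePrymWeilWeilSixfoldsSqrtMinus7HodgeRiemannOne
import Summits.HodgeConjecture.HodgeConjecture.Theorems.HeckePrymWeilWeilSixfoldsSqrtMinus7HyperplaneCalculusSym
import Summits.HodgeConjecture.HodgeConjecture.Theorems.HeckePrymWeilWeilSixfoldsSqrtMinus7BaseChangeModel
import Summits.HodgeConjecture.HodgeConjecture.Theorems.HeckePrymWeilWeilSixfoldsSqrtMinus7SplitFrameTransport
import Summits.HodgeConjecture.HodgeConjecture.Theorems.HeckePrymWeilWeilSixfoldsSqrtMinus7SplittingArithmetic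
import Summits.HodgeConjecture.HodgeConjecture.Theorems.HeckePrymWeilWeilSixfoldsSqrtMinus7Untwisting
import Summits.HodgeConjecture.HodgeConjecture.Theorems.HeckePrymWeilWeilSixfoldsSqrtMinus7OneClassSuffices
import HarnessLib.Audit

/-!
# Skeleton line `real-quadratic-base-change` for crux `WeilSixfoldsSqrtMinus7` (stmt-HodgeConjecture-1260)
# — LEAD RESHAPE r1 (lead c2, `prover-line-stmt-HodgeConjecture-1260-c2-0`, 2026-08-16)

Route `HeckePrymWeil`, crux r2 `WeilSixfoldsSqrtMinus7` = "on every complex abelian SIXFOLD `A` with an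
endomorphism `φ`, `φ ≫ φ = -7` (`K = ℚ(√-7) ↪ End⁰ A`), every rational `(3,3)`-class in the (complexified)
Weil plane — typed as `Eig((𝟙+φ)^*, (1+i√7)⁶) ⊔ Eig((𝟙+φ)^*, (1-i√7)⁶) ⊆ H⁶(A(ℂ);ℂ)` — is algebraic"
(all discriminants `det H ∈ ℚ^×/Nm K^×`; known: the hyperbolic class `det H = -1`, Markman
arXiv:2502.03415; open otherwise, arXiv:2603.20268 §1).

## The line (crux idea `real-quadratic-base-change`, ideator r1 k1; triage r1: pass ×2; planner skeleton
`planner-cruxplan-stmt-HodgeConjecture-1260-real-quadratic-base--0`, 2026-08-16T00:23Z)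

LEVER. Base change `A ↦ A ⊗_ℤ O_F = A × A` along a real quadratic field `F = ℚ(√t)`:
`ψ_K := φ × φ` (`ψ_K² = -7`) and `ψ_F := (x, y) ↦ (t·y, x)` (`ψ_F² = t`, commuting with `ψ_K`; PROVED
below, `psiK_comp_psiK`, `psiF_comp_psiF`, `psiK_comm_psiF`) make `A × A` an abelian 12-fold
(`dim_bc`) with multiplication by the CM field `L = ℚ(√-7, √t)`, of `L`-Weil type `(3,3)⁴` when `A` is
of `K`-Weil type `(3,3)`; its `L`-Weil space `W_L = ∧⁶_L H¹ ⊆ H⁶(·, ℚ)` (`dim_ℚ 4`) complexifies to the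
four JOINT eigen-lines of `(𝟙+ψ_K)^*`, `(𝟙+ψ_F)^*` (the "L-Weil span" written out in every stub below).
UNTWISTING (`stub_untwisting`): the `K`-Weil classes of `A` are algebraic as soon as the `L`-Weil classes
of `A ⊗ O_F` are. SPLITTING (`stub_splittingArithmetic` + `stub_baseChangeModel` +
`stub_splitFrameTransport`, assembled below as `baseChangeSplitting_of_parts`): for ONE `t` per
discriminant class the polarized `(A × A, ψ_K, ψ_F, h)` is of SPLIT (relatively hyperbolic) `L`-Weil type.
TARGET `C⁺(F)` (`stub_splitSecantClass`, HARDEST, OPEN = Markman's relative secant programme,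
arXiv:2509.23079, at `(d, e, n) = (6, 4, 6)`): on every polarized split `L`-Weil 12-fold ONE non-zero
rational `L`-Weil class is algebraic; `stub_oneClassSuffices` turns one class into all.

## Status after wave 1 (r4, ~20:10Z): EVERY PROVABLE STUB LANDED — the skeleton has ONE `sorry`, S3 (open mathematics)
LANDED: S1 `stub_untwisting` p122498 (+ lemmas p121749), S2a `stub_splittingArithmetic` p121641 (+ core p121358),
S2b `stub_baseChangeModel` p121253, S2c `stub_splitFrameTransport` p120974, planner STUB 2 `baseChangeSplitting` p122001,
S4 `stub_oneClassSuffices` p122734 (+ p122313, p122559). The crux is therefore, in Lean and on the real carriers,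
EXACTLY the transferred crux C⁺(F) = `stub_splitSecantClass` (composition file
`Theorems/HeckePrymWeilWeilSixfoldsSqrtMinus7OfSplitSecantClass.lean`: `weilSixfoldsSqrtMinus7_of_splitSecantClass`).

## Lead reshape r1 (this seat) — what changed w.r.t. the planner skeleton and why

* The four planner stubs are kept with the SAME mathematics, but their signatures are now written out on
  the tree's carriers with NO local definition (`KWeilAlgebraic`, `LWeilAlgebraic`, `lWeilSpan`,
  `SplitFrame`, `lSymmPolarizationClass`, `bc`, `psiK`, `psiF` are unfolded textually), so that each stub
  can land verbatim as a `Theorems/` file (Theorems cannot import `Cruxes/`), and the composition takes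
  the stubs as name-keyed `Registered.stub_*` hypotheses (the audit admits hypotheses BY NAME).
* `stub_baseChangeSplitting` (planner STUB 2) is DECOMPOSED into three registered sub-goals and an
  assembly proved here from landed theorems of line 1 (`stub_weilSignature_of` = the rational degree-one
  model WITH signature of a Weil-type `(A, φ, h_A)`, G3; `stub_hodgeRiemannOne`, `hodgeRiemannOne_symmetrised`;
  `stub_hyperplaneCalculusSym`, G4′):
  - `stub_splittingArithmetic` (lead's own): pure `ℚ`-linear algebra — from `(M, G)` with `M² = -7`,
    `G` alternating `M`-compatible of signature `(6,6)` for `x ↦ G(x, Mx)`, produce `t > 0` non-square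
    and 12 independent rational coefficient vectors in `ℚ¹² ⊕ ℚ¹²` spanning an `(M ⊕ M)`- and
    `Ψ_t = (x,y) ↦ (y, tx)`-stable subspace, totally isotropic for `tG ⊕ G` (Meyer twice splits the
    hermitian form `H = 2·Hyp ⊥ ⟨a,-b⟩`; choose `t = ab·s²`; third isotropic `L`-line `(√t/(sa))e₁ + e₂`);
  - `stub_baseChangeModel`: the rational degree-one model of the BASE CHANGE — on the Künneth frame
    `(fst^*u, snd^*u)` of `A × A`, `ψ_K^*` has matrix `M ⊕ M`, `ψ_F^*` has matrix `(0 1; t 0)`, and the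
    polarization pairing of the `L`-symmetrised hyperplane class of a Segre embedding,
    `h = (7 + ψ_K^*)(t + ψ_F^*) e^*a' = (1+t)(fst^* h_A + t·snd^* h_A)`, has Gram matrix
    `r·(tG ⊕ G)` (`r = 462 d₀ t⁵ (1+t)¹¹`; the tree's `polarizationPairingOne_sumElim`);
  - `stub_splitFrameTransport`: model + isotropic stable coefficient vectors ⇒ the split frame (the
    tree's `isHyperbolicWeilType_of_rationalModel` with a second stabilising operator).
* Disproof used: `Cruxes/WeilSixfoldsSqrtMinus7/Disproof.lean` cycles 1–2b (no kill; §6: the `⊔` is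
  essential and the two components of a rational Weil class are conjugate and both non-zero — honoured:
  every stub keeps `IsRationalClass` + `IsOfHodgeType (3,3)` and the full join; §7 targets line 1 only).
  `a ≠ 0` and `¬ IsSquare t` stay in C⁺ (costume guards, planner card §Disproof used (iii)).
-/

noncomputable section

-- single-problem summit (Problem = Summit): the mandated namespace repeats `HodgeConjecture`.
set_option linter.dupNamespace false

open CategoryTheory
open Literature.AlgebraicGeometry.Motives
open Literature.AlgebraicGeometry.HodgeTheory
open Literature.AlgebraicGeometry.Motives.AbelianVariety
open Literature.AlgebraicTopology.SingularHomology
open Literature.Geometry.Kaehler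

namespace Summit.HodgeConjecture.HodgeConjecture.Cruxes.WeilSixfoldsSqrtMinus7.RealQuadraticBaseChange

/-! ### Product bookkeeping (PROVED): `A ⊗ O_F = A × A` is a 12-fold with commuting `ψ_K² = -7`, `ψ_F² = t` -/

/-- The base change `A ⊗_ℤ O_F = A × A` (`F = ℚ(√t)`, coordinates in the basis `1, √t`). -/
abbrev bc (A : AbelianVariety ℂ) : AbelianVariety ℂ := A.prod A

/-- `ψ_K = φ × φ` on `A × A`. -/
abbrev psiK (A : AbelianVariety ℂ) (φ : A ⟶ A) : bc A ⟶ bc A :=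
  prodLift (fst A A ≫ φ) (snd A A ≫ φ)

/-- `ψ_F = √t ⊗ 1` on `A ⊗ O_F = A × A`: `(x, y) ↦ (t·y, x)`. -/
abbrev psiF (A : AbelianVariety ℂ) (t : ℕ) : bc A ⟶ bc A :=
  prodLift ((t : ℤ) • snd A A) (fst A A)

/-- `dim (A × A) = 12` for a sixfold `A` (`AbelianVariety.dim_prod`). -/
theorem dim_bc {A : AbelianVariety ℂ} (hA : A.dim = 6) : (bc A).dim = 12 := by
  rw [dim_prod]; omega

/-- `ψ_K ≫ ψ_K = -7` on `A × A` (componentwise, `prod_hom_ext`). -/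
theorem psiK_comp_psiK {A : AbelianVariety ℂ} {φ : A ⟶ A} (hφ : φ ≫ φ = -((7 : ℤ) • 𝟙 A)) :
    psiK A φ ≫ psiK A φ = -((7 : ℤ) • 𝟙 (bc A)) := by
  apply prod_hom_ext
  · rw [Category.assoc, prodLift_fst, ← Category.assoc, prodLift_fst, Category.assoc, hφ]
    simp [Preadditive.comp_neg, Preadditive.neg_comp]
  · rw [Category.assoc, prodLift_snd, ← Category.assoc, prodLift_snd, Category.assoc, hφ]
    simp [Preadditive.comp_neg, Preadditive.neg_comp]

/-- `ψ_F ≫ ψ_F = t` on `A × A`: `(x, y) ↦ (t·y, x) ↦ (t·x, t·y)`. -/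
theorem psiF_comp_psiF (A : AbelianVariety ℂ) (t : ℕ) :
    psiF A t ≫ psiF A t = (t : ℤ) • 𝟙 (bc A) := by
  apply prod_hom_ext
  · rw [Category.assoc, prodLift_fst, Preadditive.comp_zsmul, prodLift_snd, Preadditive.zsmul_comp,
      Category.id_comp]
  · rw [Category.assoc, prodLift_snd, prodLift_fst, Preadditive.zsmul_comp, Category.id_comp]

/-- `ψ_K ≫ ψ_F = ψ_F ≫ ψ_K` (`L = K·F` is commutative: `(φx, φy) ↦ (t·φy, φx) = ψ_K(t·y, x)`). -/
theorem psiK_comm_psiF (A : AbelianVariety ℂ) (φ : A ⟶ A) (t : ℕ) :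
    psiK A φ ≫ psiF A t = psiF A t ≫ psiK A φ := by
  apply prod_hom_ext
  · rw [Category.assoc, prodLift_fst, Preadditive.comp_zsmul, prodLift_snd, Category.assoc,
      prodLift_fst, ← Category.assoc, prodLift_fst, Preadditive.zsmul_comp]
  · rw [Category.assoc, prodLift_snd, prodLift_fst, Category.assoc, prodLift_snd, ← Category.assoc,
      prodLift_snd]

/-! ### The registered stubs (signatures written out on the carriers; no local definition occurs in them)

Notation used in the docstrings only: for a 12-fold `B` with `ψ_K ≫ ψ_K = -7`, `ψ_F ≫ ψ_F = t`,
`E_K^± = Eig((𝟙+ψ_K)^*|H⁶, (1 ± i√7)⁶)`, `E_F^± = Eig((𝟙+ψ_F)^*|H⁶, (1 ± √t)⁶)`, the L-WEIL SPAN is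
`((E_K⁺ ⊓ E_F⁺) ⊔ (E_K⁺ ⊓ E_F⁻)) ⊔ ((E_K⁻ ⊓ E_F⁺) ⊔ (E_K⁻ ⊓ E_F⁻))`; the `L`-SYMMETRISED HYPERPLANE CLASS
of an embedding `e : B ↪ ℙᴺ` and `a ∈ H²(ℙᴺ)` is `h = 7·((t·e^*a) + ψ_F^* e^*a) + ψ_K^*((t·e^*a) + ψ_F^* e^*a)`;
a SPLIT FRAME is a rational, `ℂ`-independent `u : Fin 12 → H¹(B(ℂ);ℂ)` spanning a `ψ_K^*`- and
`ψ_F^*`-stable subspace, pairwise isotropic for `Q_h = h¹¹ ⌣ (· ⌣ ·)` (`polarizationPairingOne B.X h 11`). -/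

/-- **STUB 1 `stub_untwisting` (UNTWISTING, the lever's descent half).** For a sixfold `(A, φ)`,
`φ ≫ φ = -7`, and `t > 0`: if every rational `(3,3)` class of `H⁶((A×A)(ℂ);ℂ)` in the `L`-Weil span of
`(A × A, ψ_K = φ×φ, ψ_F = prodLift (t•snd) fst)` is algebraic, then every rational `(3,3)` class `c` in the
`K`-Weil plane of `(A, φ)` is algebraic. Proof plan (NO Künneth needed): put
`c̃ := Σ_{m=0..6} a_m (fst + m•snd)^* c` with `Σ_m a_m m^k = (√t)^k + (−√t)^k` (Vandermonde over `ℚ`);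
`c̃` is rational and `(3,3)` (pull-backs along morphisms of smooth projective varieties, sums, rational
multiples); for the section `ι = prodLift (𝟙 A) 0`, `ι ≫ (fst + m•snd) = 𝟙`, so `ι^* c̃ = 2c`, and
`ι^*` preserves algebraic classes (`map_mem_algebraicClasses_of_abelianVariety`, PROVED); `c̃` lies in the
`L`-Weil span: `K`-part from `(𝟙+ψ_K) ≫ (a•fst + b•snd) = (a•fst + b•snd) ≫ (𝟙+φ)`, `F`-part from
`(𝟙+ψ_F) ≫ (a•fst + b•snd) = (a+b)•fst + (ta+b)•snd` and the POLYNOMIALITY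
`(a•fst + b•snd)^* y = Σ_k a^{6-k} b^k C_k` on `H⁶ = ⋀⁶H¹` (`abelianVarietyCohomologyExteriorH1_holds`,
`complexBetti_map_hom_mul_deg_one`): `x_± := Σ_k (±√t)^k C_k` are `(𝟙+ψ_F)^*`-eigen for `(1 ± √t)⁶`
(evaluate `(1+X)^{6-j}(t+X)^j` at `X = ±√t`), `c̃_{K±} = x₊ + x₋`; joint membership since
`ψ_K ψ_F = ψ_F ψ_K`. [cite: Markman2025SecantRealMultiplication, §1.1] [cite: vanGeemen1994HodgeAV, 4.9 and Thm. 6.12]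
[informal size L] -/
theorem stub_untwisting :
    ∀ (A : AbelianVariety ℂ) (φ : A ⟶ A), A.dim = 6 → φ ≫ φ = -((7 : ℤ) • 𝟙 A) → ∀ t : ℕ, 0 < t →
      (∀ c : complexBetti (A.prod A).X 6, IsRationalClass c → IsOfHodgeType 12 (A.prod A).X 6 3 3 c →
        c ∈ ((Module.End.eigenspace (complexBetti.map (𝟙 (A.prod A) +
                  prodLift (fst A A ≫ φ) (snd A A ≫ φ)).hom.hom.hom 6).hom
                  ((1 + Complex.I * (Real.sqrt (7 : ℝ) : ℂ)) ^ 6) ⊓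
                Module.End.eigenspace (complexBetti.map (𝟙 (A.prod A) +
                  prodLift ((t : ℤ) • snd A A) (fst A A)).hom.hom.hom 6).hom
                  ((1 + (Real.sqrt (t : ℝ) : ℂ)) ^ 6)) ⊔
              (Module.End.eigenspace (complexBetti.map (𝟙 (A.prod A) +
                  prodLift (fst A A ≫ φ) (snd A A ≫ φ)).hom.hom.hom 6).hom
                  ((1 + Complex.I * (Real.sqrt (7 : ℝ) : ℂ)) ^ 6) ⊓
                Module.End.eigenspace (complexBetti.map (𝟙 (A.prod A) +
                  prodLift ((t : ℤ) • snd A A) (fst A A)).hom.hom.hom 6).hom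
                  ((1 - (Real.sqrt (t : ℝ) : ℂ)) ^ 6))) ⊔
             ((Module.End.eigenspace (complexBetti.map (𝟙 (A.prod A) +
                  prodLift (fst A A ≫ φ) (snd A A ≫ φ)).hom.hom.hom 6).hom
                  ((1 - Complex.I * (Real.sqrt (7 : ℝ) : ℂ)) ^ 6) ⊓
                Module.End.eigenspace (complexBetti.map (𝟙 (A.prod A) +
                  prodLift ((t : ℤ) • snd A A) (fst A A)).hom.hom.hom 6).hom
                  ((1 + (Real.sqrt (t : ℝ) : ℂ)) ^ 6)) ⊔
              (Module.End.eigenspace (complexBetti.map (𝟙 (A.prod A) +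
                  prodLift (fst A A ≫ φ) (snd A A ≫ φ)).hom.hom.hom 6).hom
                  ((1 - Complex.I * (Real.sqrt (7 : ℝ) : ℂ)) ^ 6) ⊓
                Module.End.eigenspace (complexBetti.map (𝟙 (A.prod A) +
                  prodLift ((t : ℤ) • snd A A) (fst A A)).hom.hom.hom 6).hom
                  ((1 - (Real.sqrt (t : ℝ) : ℂ)) ^ 6))) →
        c ∈ algebraicClasses (A.prod A).X 3) →
      ∀ c : complexBetti A.X 6, IsRationalClass c → IsOfHodgeType 6 A.X 6 3 3 c →
        c ∈ Module.End.eigenspace (complexBetti.map (𝟙 A + φ).hom.hom.hom 6).hom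
              ((1 + Complex.I * (Real.sqrt (7 : ℝ) : ℂ)) ^ 6) ⊔
            Module.End.eigenspace (complexBetti.map (𝟙 A + φ).hom.hom.hom 6).hom
              ((1 - Complex.I * (Real.sqrt (7 : ℝ) : ℂ)) ^ 6) →
        c ∈ algebraicClasses A.X 3 :=
  -- CLOSED (wave 1, worker w-untwist, p122498; lemmas p121749): Theorems/HeckePrymWeilWeilSixfoldsSqrtMinus7Untwisting(Lemmas).lean
  Summit.HodgeConjecture.HodgeConjecture.Theorems.WeilSixfoldsSqrtMinus7.RealQuadraticBaseChange.stub_untwisting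

/-- **STUB 2a `stub_splittingArithmetic` (the lead's own stub; pure `ℚ`-linear algebra = Landherr for
the relative hermitian form `H_A ⊗_K L`, made explicit).** Let `M, G` be rational `12 × 12` matrices with
`M² = -7`, `G` alternating and `M`-compatible (`G(Mx, My) = 7 G(x, y)`), such that the symmetric form
`x ↦ G(x, Mx)` has an `M`-stable positive definite `6`-space `P` and an `M`-stable negative definite
`6`-space `N` with `P ⊓ N = ⊥` (signature `(6,6)`; this is the output format of line 1's G3
`stub_weilSignature`). Then there are `t > 0` NON-SQUARE and `12` `ℚ`-independent vectors
`b_k ∈ ℚ¹² ⊕ ℚ¹²` spanning a subspace stable under `M ⊕ M` and under `Ψ_t = (0 1; t·1 0)` (`(x, y) ↦ (y, t x)`),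
pairwise isotropic for the block form `tG ⊕ G`. Proof plan: `K = ℚ[M]`, hermitian `H` ↔ `(G, M)`;
the trace form `x ↦ G(x, Mx)` is non-degenerate of signature `(6,6)` on `ℚ¹²`, so Meyer (tree:
`meyer_holds`) gives an isotropic `x₁`, the `K`-line `⟨x₁, Mx₁⟩` is totally isotropic, split off a
hyperbolic `K`-plane; again on the complement (`ℚ`-dim 8); the residual binary hermitian form is
`⟨a, -b⟩` with `a, b > 0` (dimension count against `P`, `N`); take `t := a b s²` (a positive non-square
integer — if `ab ∈ (ℚ^×)²` then `H` is `K`-hyperbolic and any non-square `t` works), and the third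
isotropic `L`-line through `e₂ + (√t/(s a))·e₁`; in coordinates `(x, y) ↔ y + √t x`.
[cite: vanGeemen1994HodgeAV, Lemma 5.2 (3) and 5.4 (5.4.1)] [cite: Markman2025SecantRealMultiplication, Lemma 8.3.4 (2)]
[informal size L] -/
theorem stub_splittingArithmetic :
    ∀ (M G : Matrix (Fin 12) (Fin 12) ℚ),
      (∀ v, M.mulVec (M.mulVec v) = -((7 : ℚ) • v)) →
      (∀ x y : Fin 12 → ℚ, y ⬝ᵥ G.mulVec x = -(x ⬝ᵥ G.mulVec y)) →
      (∀ x y : Fin 12 → ℚ, M.mulVec x ⬝ᵥ G.mulVec (M.mulVec y) = 7 * (x ⬝ᵥ G.mulVec y)) →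
      (∃ P N : Submodule ℚ (Fin 12 → ℚ),
        (∀ v ∈ P, M.mulVec v ∈ P) ∧ (∀ v ∈ N, M.mulVec v ∈ N) ∧
        Module.finrank ℚ P = 6 ∧ Module.finrank ℚ N = 6 ∧ P ⊓ N = ⊥ ∧
        (∀ x ∈ P, x ≠ 0 → 0 < x ⬝ᵥ G.mulVec (M.mulVec x)) ∧
        (∀ x ∈ N, x ≠ 0 → x ⬝ᵥ G.mulVec (M.mulVec x) < 0)) →
      ∃ (t : ℕ) (b : Fin 12 → (Fin 12 ⊕ Fin 12) → ℚ), 0 < t ∧ ¬ IsSquare t ∧ LinearIndependent ℚ b ∧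
        (∀ k, ∃ c : Fin 12 → ℚ, (Matrix.fromBlocks M 0 0 M).mulVec (b k) = ∑ l, c l • b l) ∧
        (∀ k, ∃ c : Fin 12 → ℚ,
          (Matrix.fromBlocks (0 : Matrix (Fin 12) (Fin 12) ℚ) 1 ((t : ℚ) • (1 : Matrix (Fin 12) (Fin 12) ℚ)) 0).mulVec
            (b k) = ∑ l, c l • b l) ∧
        ∀ k l, ∑ s, ∑ s', b k s * (Matrix.fromBlocks ((t : ℚ) • G) 0 0 G) s s' * b l s' = 0 :=
  -- CLOSED (cycle 1, lead c2, p121641; rational core `exists_splitSubspace` p121358):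
  -- Theorems/HeckePrymWeilWeilSixfoldsSqrtMinus7SplittingArithmetic(Core).lean
  Summit.HodgeConjecture.HodgeConjecture.Theorems.WeilSixfoldsSqrtMinus7.RealQuadraticBaseChange.stub_splittingArithmetic

/-- **STUB 2b `stub_baseChangeModel` (the rational degree-one model of the base change).** For a
sixfold `(A, φ)`, `φ ≫ φ = -7`, a projective embedding `e_A` with a rational `a ≠ 0` in `H²(ℙᴺ)`, and a
rational degree-one model `(u, M, G, ω, d₀)` of `(A, φ, h_A)`, `h_A = 7·e_A^*a + φ^*e_A^*a` the
`K`-symmetrised hyperplane class (format of line 1's G3: `φ^* u_i = Σ_k M_{ki} u_k`,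
`Q_{h_A,5}(u_i, u_k) = G_{ik} ω`, `h_A⁶ = d₀ ω`), and every `t > 0`: there are a projective embedding `e`
of `A × A` and a rational `a' ≠ 0` (in print: the Segre embedding `σ ∘ (e_A × e_A)` and `a' = q·c₁(𝒪(1))`,
`a = q·c₁(𝒪(1))` by clause (6) of `stub_hyperplaneCalculusSym`; clause (4) gives
`e^* a' = fst^* e_A^* a + snd^* e_A^* a`) such that on the Künneth frame `w = (fst^* u_i)_i ⊔ (snd^* u_i)_i`
of `H¹((A×A)(ℂ);ℂ)`: `ψ_K^*` (`ψ_K = φ × φ`) has matrix `M ⊕ M` (`map_prodLift_map_fst/snd`); `ψ_F^*`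
(`ψ_F = prodLift (t•snd) fst`) has matrix `(0 1; t·1 0)`, i.e. `ψ_F^* fst^* u_i = t·snd^* u_i`,
`ψ_F^* snd^* u_i = fst^* u_i` (`ψ_F ≫ fst = t•snd`, `ψ_F ≫ snd = fst`, degree-one primitivity
`complexBetti_map_hom_mul_deg_one`); and the polarization pairing `Q_{h,11}` of the `L`-symmetrised
hyperplane class `h = 7·(t·e^*a' + ψ_F^*e^*a') + ψ_K^*(t·e^*a' + ψ_F^*e^*a')`, which equals
`(1+t)·(fst^* h_A + t·snd^* h_A)` (`ψ_F^* fst^* x = t²·snd^* x` on `H²` via `t•snd = snd ≫ (t•𝟙)` and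
`complexBetti_map_nsmul_id_apply`; `ψ_K^* fst^* = fst^* φ^*`), has Gram matrix `r·(tG ⊕ G)` with respect
to a top class `Ω` (`= fst^*ω ⌣ snd^*ω`, `r = 462·d₀·t⁵·(1+t)¹¹`; the tree's
`polarizationPairingOne_sumElim` at `jA = jB = 5`, `m = 11`, with `polarizationPairingOne_smul`,
`lefschetzPow_smul`). [cite: vanGeemen1994HodgeAV, Lemma 5.2 (1)–(3)] [cite: LangeBirkenhake1992, Lemma 1.7.4]
[informal size L] -/
theorem stub_baseChangeModel :
    ∀ (A : AbelianVariety ℂ) (φ : A ⟶ A), A.dim = 6 → φ ≫ φ = -((7 : ℤ) • 𝟙 A) →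
      ∀ (eA : ProjectiveEmbedding A.X) (a : complexBetti (projectiveSpace eA.n ℂ) 2),
        IsRationalClass a → a ≠ 0 →
      ∀ (u : Fin 12 → complexBetti A.X 1) (M G : Matrix (Fin 12) (Fin 12) ℚ)
        (ω : complexBetti A.X (2 + 2 * 5)) (d₀ : ℚ),
        (∀ i, IsRationalClass (u i)) → LinearIndependent ℂ u → Submodule.span ℂ (Set.range u) = ⊤ →
        (∀ i, complexBetti.map φ.hom.hom.hom 1 (u i) = ∑ k, ((M k i : ℚ) : ℂ) • u k) →
        (∀ i k, polarizationPairingOne A.X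
            ((7 : ℂ) • complexBetti.map eA.ι 2 a + complexBetti.map φ.hom.hom.hom 2 (complexBetti.map eA.ι 2 a))
            5 (u i) (u k) = ((G i k : ℚ) : ℂ) • ω) →
        lefschetzPow
            ((7 : ℂ) • complexBetti.map eA.ι 2 a + complexBetti.map φ.hom.hom.hom 2 (complexBetti.map eA.ι 2 a))
            5 2
            ((7 : ℂ) • complexBetti.map eA.ι 2 a + complexBetti.map φ.hom.hom.hom 2 (complexBetti.map eA.ι 2 a)) =
          ((d₀ : ℚ) : ℂ) • ω →
      ∀ t : ℕ, 0 < t →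
        ∃ (e : ProjectiveEmbedding (A.prod A).X) (a' : complexBetti (projectiveSpace e.n ℂ) 2) (r : ℚ)
          (Ω : complexBetti (A.prod A).X (2 + 2 * 11)),
          IsRationalClass a' ∧ a' ≠ 0 ∧
          (∀ k : Fin 12 ⊕ Fin 12, complexBetti.map (prodLift (fst A A ≫ φ) (snd A A ≫ φ)).hom.hom.hom 1
              (Sum.elim (fun i => complexBetti.map (fst A A).hom.hom.hom 1 (u i))
                (fun i => complexBetti.map (snd A A).hom.hom.hom 1 (u i)) k) =
            ∑ l, ((Matrix.fromBlocks M 0 0 M l k : ℚ) : ℂ) •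
              Sum.elim (fun i => complexBetti.map (fst A A).hom.hom.hom 1 (u i))
                (fun i => complexBetti.map (snd A A).hom.hom.hom 1 (u i)) l) ∧
          (∀ k : Fin 12 ⊕ Fin 12, complexBetti.map (prodLift ((t : ℤ) • snd A A) (fst A A)).hom.hom.hom 1
              (Sum.elim (fun i => complexBetti.map (fst A A).hom.hom.hom 1 (u i))
                (fun i => complexBetti.map (snd A A).hom.hom.hom 1 (u i)) k) =
            ∑ l, ((Matrix.fromBlocks (0 : Matrix (Fin 12) (Fin 12) ℚ) 1
                    ((t : ℚ) • (1 : Matrix (Fin 12) (Fin 12) ℚ)) 0 l k : ℚ) : ℂ) •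
              Sum.elim (fun i => complexBetti.map (fst A A).hom.hom.hom 1 (u i))
                (fun i => complexBetti.map (snd A A).hom.hom.hom 1 (u i)) l) ∧
          (∀ k l : Fin 12 ⊕ Fin 12, polarizationPairingOne (A.prod A).X
              ((7 : ℂ) • (((t : ℂ) • complexBetti.map e.ι 2 a' +
                  complexBetti.map (prodLift ((t : ℤ) • snd A A) (fst A A)).hom.hom.hom 2
                    (complexBetti.map e.ι 2 a'))) +
                complexBetti.map (prodLift (fst A A ≫ φ) (snd A A ≫ φ)).hom.hom.hom 2
                  ((t : ℂ) • complexBetti.map e.ι 2 a' +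
                    complexBetti.map (prodLift ((t : ℤ) • snd A A) (fst A A)).hom.hom.hom 2
                      (complexBetti.map e.ι 2 a')))
              11
              (Sum.elim (fun i => complexBetti.map (fst A A).hom.hom.hom 1 (u i))
                (fun i => complexBetti.map (snd A A).hom.hom.hom 1 (u i)) k)
              (Sum.elim (fun i => complexBetti.map (fst A A).hom.hom.hom 1 (u i))
                (fun i => complexBetti.map (snd A A).hom.hom.hom 1 (u i)) l) =
            ((r * Matrix.fromBlocks ((t : ℚ) • G) 0 0 G k l : ℚ) : ℂ) • Ω) :=
  -- CLOSED (wave 1, worker w-model, p121253): Theorems/HeckePrymWeilWeilSixfoldsSqrtMinus7BaseChangeModel.lean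
  Summit.HodgeConjecture.HodgeConjecture.Theorems.WeilSixfoldsSqrtMinus7.RealQuadraticBaseChange.stub_baseChangeModel

/-- **STUB 2c `stub_splitFrameTransport` (model + isotropic stable coefficients ⇒ split frame; the
transport step, van Geemen 5.2 (2)–(3)/5.4 read in coordinates, with TWO stabilising operators).**
On any `B` with endomorphisms `ψ_K, ψ_F`, a class `h ∈ H²` and a rational, `ℂ`-independent frame
`w : Fin 12 ⊕ Fin 12 → H¹(B(ℂ);ℂ)` in which `ψ_K^*`, `ψ_F^*` have rational matrices `MM`, `ΨΨ` and
`Q_{h,11}` has rational Gram matrix `GG` (times a class `Ω`): twelve `ℚ`-independent coefficient vectors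
`b_k` spanning an `MM`- and `ΨΨ`-stable subspace, pairwise `GG`-isotropic, give the classes
`u_k = Σ_s b_{k,s} w_s`, which are rational, `ℂ`-independent (`linearIndependent_iff_of_isRationalClass`),
span a `ψ_K^*`- and `ψ_F^*`-stable subspace and are pairwise `Q_{h,11}`-isotropic — verbatim the proof
of the tree's `isHyperbolicWeilType_of_rationalModel`, run twice for the stability clause.
[cite: vanGeemen1994HodgeAV, Lemma 5.2 (2)–(3) and 5.4 (5.4.1)] [informal size M] -/
theorem stub_splitFrameTransport :
    ∀ (B : AbelianVariety ℂ) (ψK ψF : B ⟶ B) (h : complexBetti B.X 2)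
      (w : Fin 12 ⊕ Fin 12 → complexBetti B.X 1)
      (MM ΨΨ GG : Matrix (Fin 12 ⊕ Fin 12) (Fin 12 ⊕ Fin 12) ℚ) (Ω : complexBetti B.X (2 + 2 * 11)),
      (∀ k, IsRationalClass (w k)) → LinearIndependent ℂ w →
      (∀ k, complexBetti.map ψK.hom.hom.hom 1 (w k) = ∑ l, ((MM l k : ℚ) : ℂ) • w l) →
      (∀ k, complexBetti.map ψF.hom.hom.hom 1 (w k) = ∑ l, ((ΨΨ l k : ℚ) : ℂ) • w l) →
      (∀ k l, polarizationPairingOne B.X h 11 (w k) (w l) = ((GG k l : ℚ) : ℂ) • Ω) →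
      ∀ (b : Fin 12 → (Fin 12 ⊕ Fin 12) → ℚ), LinearIndependent ℚ b →
        (∀ k, ∃ c : Fin 12 → ℚ, MM.mulVec (b k) = ∑ l, c l • b l) →
        (∀ k, ∃ c : Fin 12 → ℚ, ΨΨ.mulVec (b k) = ∑ l, c l • b l) →
        (∀ k l, ∑ s, ∑ s', b k s * GG s s' * b l s' = 0) →
        ∃ u : Fin 12 → complexBetti B.X 1,
          (∀ i, IsRationalClass (u i)) ∧ LinearIndependent ℂ u ∧
          (∀ i, complexBetti.map ψK.hom.hom.hom 1 (u i) ∈ Submodule.span ℂ (Set.range u)) ∧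
          (∀ i, complexBetti.map ψF.hom.hom.hom 1 (u i) ∈ Submodule.span ℂ (Set.range u)) ∧
          ∀ i j, polarizationPairingOne B.X h 11 (u i) (u j) = 0 :=
  -- CLOSED (wave 1, worker w-transport, p120974): Theorems/HeckePrymWeilWeilSixfoldsSqrtMinus7SplitFrameTransport.lean
  Summit.HodgeConjecture.HodgeConjecture.Theorems.WeilSixfoldsSqrtMinus7.RealQuadraticBaseChange.stub_splitFrameTransport

/-- **STUB 3 `stub_splitSecantClass` (XL, OPEN — the line's target `C⁺(F)` = Markman's relative secant
programme at `(d, e, n) = (6, 4, 6)`; HARDEST).** On every polarized abelian 12-fold `(B, ψ_K, ψ_F, h)`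
with commuting `ψ_K² = -7`, `ψ_F² = t` (`t > 0` non-square), `h` the `L`-symmetrised hyperplane class of a
projective embedding `e` and a rational `a ≠ 0` (`±` an ample `L`-compatible polarization), of SPLIT
`L`-Weil type (a rational `ℂ`-independent `ψ_K^*`-, `ψ_F^*`-stable `Q_{h,11}`-isotropic 12-frame of `H¹`;
Markman arXiv:2509.23079 Lemma 8.3.4 (2), Def. 8.3.5 = Deligne–Milne), ONE non-zero rational class of the
`L`-Weil span is algebraic. Why plausibly true / the work: (1) membership `(B, η, ±E_h) ≅ ((X_F × X̂_F, I), η, Ξ_{t'})`,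
`I ∈ Ω_{B,t'}`, for any split anchor with `X_F` an RM sixfold (Lemma 10.2.3, Rem. 10.2.1/10.2.4, Lemma 12.1.2);
(2) a `B`-secant pair `F₁, F₂` on `X_F` at `(d,e) = (6,4)` with `rank Φ(F₁ ⊠ F₂^∨) ≠ 0` and Prop. 1.1.1's
genericity (UNBUILT in print, which stops at `(4,4)`); then Thm. 1.1.2: `κ(Φ(F₁ ⊠ F₂^∨))` stays Hodge on
`Ω_{B,t'}` with non-zero `HW`-projection of `κ₃`; (3) equivariant semiregularity at `e = 4` (OPEN,
"postponed", §1.1; Buchweitz–Flenner 5.1 / Pridham / Markman's twisted semiregularity, Perry 2026);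
(4) spreading over the irreducible `Ω_{B,t'}` (CDK + countability, as in arXiv:2502.03415 §1.5). Barriers:
evades `Weil1977_exceptionalHodgeClasses` / `Mumford1968_…` (the cycle is `ch` of an Orlov image of a box
product of secant sheaves, `K`-charge `±6`); uses `CattaniDeligneKaplan1995_hodgeLocus_algebraicFor`
positively; `Andre1996…motivated` refutation-side only. Costume guards: `a ≠ 0` (with `a = 0` isotropy is
vacuous) and `¬ IsSquare t` (`L` a field). Not attacked by this line's lead (open mathematics); hand-back
candidate. [cite: Markman2025SecantRealMultiplication, Thm. 1.1.2, Prop. 1.1.1, Lemma 8.3.4, Def. 8.3.5, Lemma 10.2.3, Lemma 12.1.2]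
[cite: Markman2025SecantWeil, Thm. 1.5.1 and §1.5] [cite: BuchweitzFlenner2003, Thm. 5.1] [informal size XL; open] -/
theorem stub_splitSecantClass :
    ∀ (B : AbelianVariety ℂ) (ψK ψF : B ⟶ B) (t : ℕ), B.dim = 12 → ψK ≫ ψK = -((7 : ℤ) • 𝟙 B) →
      ψF ≫ ψF = (t : ℤ) • 𝟙 B → ψK ≫ ψF = ψF ≫ ψK → 0 < t → ¬ IsSquare t →
      ∀ (e : ProjectiveEmbedding B.X) (a : complexBetti (projectiveSpace e.n ℂ) 2),
        IsRationalClass a → a ≠ 0 →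
        (∃ u : Fin 12 → complexBetti B.X 1,
          (∀ i, IsRationalClass (u i)) ∧ LinearIndependent ℂ u ∧
          (∀ i, complexBetti.map ψK.hom.hom.hom 1 (u i) ∈ Submodule.span ℂ (Set.range u)) ∧
          (∀ i, complexBetti.map ψF.hom.hom.hom 1 (u i) ∈ Submodule.span ℂ (Set.range u)) ∧
          ∀ i j, polarizationPairingOne B.X
              ((7 : ℂ) • (((t : ℂ) • complexBetti.map e.ι 2 a +
                  complexBetti.map ψF.hom.hom.hom 2 (complexBetti.map e.ι 2 a))) +
                complexBetti.map ψK.hom.hom.hom 2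
                  ((t : ℂ) • complexBetti.map e.ι 2 a + complexBetti.map ψF.hom.hom.hom 2 (complexBetti.map e.ι 2 a)))
              11 (u i) (u j) = 0) →
        ∃ c₀ : complexBetti B.X 6, IsRationalClass c₀ ∧
          c₀ ∈ ((Module.End.eigenspace (complexBetti.map (𝟙 B + ψK).hom.hom.hom 6).hom
                    ((1 + Complex.I * (Real.sqrt (7 : ℝ) : ℂ)) ^ 6) ⊓
                  Module.End.eigenspace (complexBetti.map (𝟙 B + ψF).hom.hom.hom 6).hom
                    ((1 + (Real.sqrt (t : ℝ) : ℂ)) ^ 6)) ⊔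
                (Module.End.eigenspace (complexBetti.map (𝟙 B + ψK).hom.hom.hom 6).hom
                    ((1 + Complex.I * (Real.sqrt (7 : ℝ) : ℂ)) ^ 6) ⊓
                  Module.End.eigenspace (complexBetti.map (𝟙 B + ψF).hom.hom.hom 6).hom
                    ((1 - (Real.sqrt (t : ℝ) : ℂ)) ^ 6))) ⊔
               ((Module.End.eigenspace (complexBetti.map (𝟙 B + ψK).hom.hom.hom 6).hom
                    ((1 - Complex.I * (Real.sqrt (7 : ℝ) : ℂ)) ^ 6) ⊓
                  Module.End.eigenspace (complexBetti.map (𝟙 B + ψF).hom.hom.hom 6).hom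
                    ((1 + (Real.sqrt (t : ℝ) : ℂ)) ^ 6)) ⊔
                (Module.End.eigenspace (complexBetti.map (𝟙 B + ψK).hom.hom.hom 6).hom
                    ((1 - Complex.I * (Real.sqrt (7 : ℝ) : ℂ)) ^ 6) ⊓
                  Module.End.eigenspace (complexBetti.map (𝟙 B + ψF).hom.hom.hom 6).hom
                    ((1 - (Real.sqrt (t : ℝ) : ℂ)) ^ 6))) ∧
          c₀ ≠ 0 ∧ c₀ ∈ algebraicClasses B.X 3 := by
  sorry

/-- **STUB 4 `stub_oneClassSuffices` (ONE CLASS SUFFICES; Lieberman-type, two operators).** On a 12-fold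
`B` with commuting `ψ_K² = -7`, `ψ_F² = t` (`t > 0` non-square): one non-zero rational ALGEBRAIC class `c₀`
of the `L`-Weil span makes every rational `(3,3)` class of the `L`-Weil span algebraic. Proof plan:
(i) simultaneous rational model of `H¹(B(ℂ);ℂ)` (`exists_rationalModel_one`-style: rational basis `u`,
rational commuting matrices `M_K² = -7`, `M_F² = t`); (ii) the four joint eigenspaces of `(M_K, M_F)` on
`ℂ²⁴` have dimension `6` each — TRACE argument: `tr M_K ∈ ℚ ∩ i√7·ℤ = 0`, `tr M_F ∈ ℚ ∩ √t·ℤ = 0`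
(`t` non-square), `tr (M_K M_F) ∈ ℚ ∩ i√(7t)·ℤ = 0`, and the joint projectors are
`¼(1 ± M_K/(i√7))(1 ± M_F/√t)`; (iii) `H⁶ = ⋀⁶H¹` (`abelianVarietyCohomologyExteriorH1_holds`): the
`(𝟙+ψ_K)^*`/`(𝟙+ψ_F)^*` joint eigenspaces on `H⁶` for `((1±i√7)⁶, (1±√t)⁶)` are `⋀⁶` of the joint
eigenspaces on `H¹` (eigenvalue separation: `(1+i√7)ᵃ(1-i√7)ᵇ = (1+i√7)⁶ ⇒ b = 0`, tree
`Negative/EigenvalueSeparation`; `(1+√t)ᵃ(1-√t)ᵇ = (1+√t)⁶ ⇒ b = 0` since `|1-√t| < 1+√t`), hence LINES,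
so the `L`-Weil span is 4-dimensional; (iv) all four components of the rational `c₀ ≠ 0` are non-zero
(complex conjugation swaps the `K`-sign, `WeilPlaneReality`; a rational `(𝟙+ψ_F)^*`-eigenvector with the
irrational eigenvalue `(1±√t)⁶` is `0`); (v) the classes `P((𝟙+ψ_K)^*, (𝟙+ψ_F)^*) c₀`, `P ∈ ℚ[x,y]`, are
algebraic (pull-back along endomorphisms, `map_mem_algebraicClasses_of_abelianVariety`) and span the
4-dimensional `L`-Weil span over `ℂ`; `algebraicClasses` is a `ℂ`-subspace. (The hypotheses
`IsRationalClass c`, `IsOfHodgeType … c` are then not even needed.)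
[cite: Markman2025SecantRealMultiplication, §1 p. 2] [cite: vanGeemen1994HodgeAV, proof of Thm. 6.12] [informal size L] -/
theorem stub_oneClassSuffices :
    ∀ (B : AbelianVariety ℂ) (ψK ψF : B ⟶ B) (t : ℕ), B.dim = 12 → ψK ≫ ψK = -((7 : ℤ) • 𝟙 B) →
      ψF ≫ ψF = (t : ℤ) • 𝟙 B → ψK ≫ ψF = ψF ≫ ψK → 0 < t → ¬ IsSquare t →
      (∃ c₀ : complexBetti B.X 6, IsRationalClass c₀ ∧
          c₀ ∈ ((Module.End.eigenspace (complexBetti.map (𝟙 B + ψK).hom.hom.hom 6).hom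
                    ((1 + Complex.I * (Real.sqrt (7 : ℝ) : ℂ)) ^ 6) ⊓
                  Module.End.eigenspace (complexBetti.map (𝟙 B + ψF).hom.hom.hom 6).hom
                    ((1 + (Real.sqrt (t : ℝ) : ℂ)) ^ 6)) ⊔
                (Module.End.eigenspace (complexBetti.map (𝟙 B + ψK).hom.hom.hom 6).hom
                    ((1 + Complex.I * (Real.sqrt (7 : ℝ) : ℂ)) ^ 6) ⊓
                  Module.End.eigenspace (complexBetti.map (𝟙 B + ψF).hom.hom.hom 6).hom
                    ((1 - (Real.sqrt (t : ℝ) : ℂ)) ^ 6))) ⊔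
               ((Module.End.eigenspace (complexBetti.map (𝟙 B + ψK).hom.hom.hom 6).hom
                    ((1 - Complex.I * (Real.sqrt (7 : ℝ) : ℂ)) ^ 6) ⊓
                  Module.End.eigenspace (complexBetti.map (𝟙 B + ψF).hom.hom.hom 6).hom
                    ((1 + (Real.sqrt (t : ℝ) : ℂ)) ^ 6)) ⊔
                (Module.End.eigenspace (complexBetti.map (𝟙 B + ψK).hom.hom.hom 6).hom
                    ((1 - Complex.I * (Real.sqrt (7 : ℝ) : ℂ)) ^ 6) ⊓
                  Module.End.eigenspace (complexBetti.map (𝟙 B + ψF).hom.hom.hom 6).hom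
                    ((1 - (Real.sqrt (t : ℝ) : ℂ)) ^ 6))) ∧
          c₀ ≠ 0 ∧ c₀ ∈ algebraicClasses B.X 3) →
      ∀ c : complexBetti B.X 6, IsRationalClass c → IsOfHodgeType 12 B.X 6 3 3 c →
        c ∈ ((Module.End.eigenspace (complexBetti.map (𝟙 B + ψK).hom.hom.hom 6).hom
                  ((1 + Complex.I * (Real.sqrt (7 : ℝ) : ℂ)) ^ 6) ⊓
                Module.End.eigenspace (complexBetti.map (𝟙 B + ψF).hom.hom.hom 6).hom
                  ((1 + (Real.sqrt (t : ℝ) : ℂ)) ^ 6)) ⊔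
              (Module.End.eigenspace (complexBetti.map (𝟙 B + ψK).hom.hom.hom 6).hom
                  ((1 + Complex.I * (Real.sqrt (7 : ℝ) : ℂ)) ^ 6) ⊓
                Module.End.eigenspace (complexBetti.map (𝟙 B + ψF).hom.hom.hom 6).hom
                  ((1 - (Real.sqrt (t : ℝ) : ℂ)) ^ 6))) ⊔
             ((Module.End.eigenspace (complexBetti.map (𝟙 B + ψK).hom.hom.hom 6).hom
                  ((1 - Complex.I * (Real.sqrt (7 : ℝ) : ℂ)) ^ 6) ⊓
                Module.End.eigenspace (complexBetti.map (𝟙 B + ψF).hom.hom.hom 6).hom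
                  ((1 + (Real.sqrt (t : ℝ) : ℂ)) ^ 6)) ⊔
              (Module.End.eigenspace (complexBetti.map (𝟙 B + ψK).hom.hom.hom 6).hom
                  ((1 - Complex.I * (Real.sqrt (7 : ℝ) : ℂ)) ^ 6) ⊓
                Module.End.eigenspace (complexBetti.map (𝟙 B + ψF).hom.hom.hom 6).hom
                  ((1 - (Real.sqrt (t : ℝ) : ℂ)) ^ 6))) →
        c ∈ algebraicClasses B.X 3 :=
  -- CLOSED (wave 1, worker w-oneclass, p122734; lemmas p122313, eigenlines p122559):
  -- Theorems/HeckePrymWeilWeilSixfoldsSqrtMinus7OneClassSuffices(Lemmas|Eigenlines).lean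
  Summit.HodgeConjecture.HodgeConjecture.Theorems.WeilSixfoldsSqrtMinus7.RealQuadraticBaseChange.stub_oneClassSuffices

/-! ### Name-keyed aliases of the six stub statements (the hypotheses of the composition: the native skeleton
audit admits hypotheses BY NAME — a `Registered.stub_*` head constant — exactly as in the planner skeleton) -/
namespace Registered

/-- Alias of the statement of `stub_untwisting`, keyed by the registered stub name. -/
abbrev stub_untwisting : Prop :=
  type_of% _root_.Summit.HodgeConjecture.HodgeConjecture.Cruxes.WeilSixfoldsSqrtMinus7.RealQuadraticBaseChange.stub_untwisting
/-- Alias of the statement of `stub_splittingArithmetic`, keyed by the registered stub name. -/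
abbrev stub_splittingArithmetic : Prop :=
  type_of% _root_.Summit.HodgeConjecture.HodgeConjecture.Cruxes.WeilSixfoldsSqrtMinus7.RealQuadraticBaseChange.stub_splittingArithmetic
/-- Alias of the statement of `stub_baseChangeModel`, keyed by the registered stub name. -/
abbrev stub_baseChangeModel : Prop :=
  type_of% _root_.Summit.HodgeConjecture.HodgeConjecture.Cruxes.WeilSixfoldsSqrtMinus7.RealQuadraticBaseChange.stub_baseChangeModel
/-- Alias of the statement of `stub_splitFrameTransport`, keyed by the registered stub name. -/
abbrev stub_splitFrameTransport : Prop :=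
  type_of% _root_.Summit.HodgeConjecture.HodgeConjecture.Cruxes.WeilSixfoldsSqrtMinus7.RealQuadraticBaseChange.stub_splitFrameTransport
/-- Alias of the statement of `stub_splitSecantClass`, keyed by the registered stub name. -/
abbrev stub_splitSecantClass : Prop :=
  type_of% _root_.Summit.HodgeConjecture.HodgeConjecture.Cruxes.WeilSixfoldsSqrtMinus7.RealQuadraticBaseChange.stub_splitSecantClass
/-- Alias of the statement of `stub_oneClassSuffices`, keyed by the registered stub name. -/
abbrev stub_oneClassSuffices : Prop :=
  type_of% _root_.Summit.HodgeConjecture.HodgeConjecture.Cruxes.WeilSixfoldsSqrtMinus7.RealQuadraticBaseChange.stub_oneClassSuffices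

end Registered

/-! ### Assembly of planner STUB 2 (base-change splitting) from 2a–2c and line 1's landed G3/G4′ (lead, r1) -/

section Assembly

/-- Scaling a Gram matrix scales the isotropy sums: `Σ b (r•GG) b = r · Σ b GG b`. -/
theorem sum_mul_smul_matrix_mul {ι κ : Type} [Fintype ι] (r : ℚ) (GG : Matrix ι ι ℚ) (b : κ → ι → ℚ)
    (k l : κ) :
    ∑ s, ∑ s', b k s * (r • GG) s s' * b l s' = r * ∑ s, ∑ s', b k s * GG s s' * b l s' := by
  simp only [Matrix.smul_apply, smul_eq_mul, Finset.mul_sum]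
  refine Finset.sum_congr rfl fun s _ => Finset.sum_congr rfl fun s' _ => ?_
  ring

/-- **Planner STUB 2 (BASE-CHANGE SPLITTING) from its registered parts — UNCONDITIONAL since r2 (S2a p121641, S2b p121253, S2c p120974 landed).** A sixfold `(A, φ)`,
`φ ≫ φ = -7`, carrying a NON-ZERO rational `(3,3)` class in its Weil plane admits `t > 0` non-square, a
projective embedding `e` of `A × A` and a rational `a ≠ 0` with a SPLIT FRAME for
`(A × A, φ × φ, prodLift (t•snd) fst)` and the `L`-symmetrised hyperplane class of `(e, a)`.
Proof: G4′ (hyperplane generators `g`), an embedding `e_A` of `A` (`isSmoothProjective_holds`),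
`a := g(e_A.n)`; G3 at `n = 3` (rational model WITH signature, fed the Weil witness); 2a (arithmetic:
`t`, `b`); 2b (model of the base change for this `t`); 2c (transport). -/
theorem baseChangeSplitting_of_parts :
    ∀ (A : AbelianVariety ℂ) (φ : A ⟶ A), A.dim = 6 → φ ≫ φ = -((7 : ℤ) • 𝟙 A) →
      (∃ c : complexBetti A.X 6, IsRationalClass c ∧ IsOfHodgeType 6 A.X 6 3 3 c ∧
        c ∈ Module.End.eigenspace (complexBetti.map (𝟙 A + φ).hom.hom.hom 6).hom
              ((1 + Complex.I * (Real.sqrt (7 : ℝ) : ℂ)) ^ 6) ⊔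
            Module.End.eigenspace (complexBetti.map (𝟙 A + φ).hom.hom.hom 6).hom
              ((1 - Complex.I * (Real.sqrt (7 : ℝ) : ℂ)) ^ 6) ∧ c ≠ 0) →
      ∃ (t : ℕ) (e : ProjectiveEmbedding (A.prod A).X) (a : complexBetti (projectiveSpace e.n ℂ) 2),
        0 < t ∧ ¬ IsSquare t ∧ IsRationalClass a ∧ a ≠ 0 ∧
        ∃ u : Fin 12 → complexBetti (A.prod A).X 1,
          (∀ i, IsRationalClass (u i)) ∧ LinearIndependent ℂ u ∧
          (∀ i, complexBetti.map (prodLift (fst A A ≫ φ) (snd A A ≫ φ)).hom.hom.hom 1 (u i) ∈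
            Submodule.span ℂ (Set.range u)) ∧
          (∀ i, complexBetti.map (prodLift ((t : ℤ) • snd A A) (fst A A)).hom.hom.hom 1 (u i) ∈
            Submodule.span ℂ (Set.range u)) ∧
          ∀ i j, polarizationPairingOne (A.prod A).X
              ((7 : ℂ) • (((t : ℂ) • complexBetti.map e.ι 2 a +
                  complexBetti.map (prodLift ((t : ℤ) • snd A A) (fst A A)).hom.hom.hom 2
                    (complexBetti.map e.ι 2 a))) +
                complexBetti.map (prodLift (fst A A ≫ φ) (snd A A ≫ φ)).hom.hom.hom 2
                  ((t : ℂ) • complexBetti.map e.ι 2 a +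
                    complexBetti.map (prodLift ((t : ℤ) • snd A A) (fst A A)).hom.hom.hom 2
                      (complexBetti.map e.ι 2 a)))
              11 (u i) (u j) = 0 := by
  intro A φ hA hφ hwit
  obtain ⟨c, hrat, hH, hW, hc⟩ := hwit
  classical
  -- G4′: hyperplane generators
  obtain ⟨g, hg_rat, hg_ne, hg_dim, -, -, -, -⟩ :=
    Summit.HodgeConjecture.HodgeConjecture.Theorems.WeilSixfoldsSqrtMinus7.HyperbolicEightfoldDescent.stub_hyperplaneCalculusSym
  -- an embedding of `A` and the class `a = g`
  obtain ⟨eA⟩ : Nonempty (ProjectiveEmbedding A.X) :=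
    ⟨(AbelianVariety.isSmoothProjective_holds (A := A)).isProjectiveOver.projectiveEmbedding⟩
  have heAn : 1 ≤ eA.n := hg_dim A eA (by omega)
  have haA : IsRationalClass (g eA.n) := hg_rat eA.n
  have haA0 : g eA.n ≠ 0 := hg_ne eA.n heAn
  -- G3 at `n = 3`: the rational degree-one model WITH signature
  have hA' : A.dim = 2 * 3 := by rw [hA]
  obtain ⟨u, M, G, ω, d₀, hu_rat, hu_ind, hu_span, hM, -, -, hG, hd₀, hM2, hGt, hGM, hPN⟩ :=
    Summit.HodgeConjecture.HodgeConjecture.Theorems.WeilSixfoldsSqrtMinus7.HyperbolicEightfoldDescent.stub_weilSignature_of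
      (Summit.HodgeConjecture.HodgeConjecture.Theorems.WeilSixfoldsSqrtMinus7.HyperbolicEightfoldDescent.hodgeRiemannOne_symmetrised
        Summit.HodgeConjecture.HodgeConjecture.Theorems.WeilSixfoldsSqrtMinus7.HyperbolicEightfoldDescent.stub_hodgeRiemannOne
        Summit.HodgeConjecture.HodgeConjecture.Theorems.WeilSixfoldsSqrtMinus7.HyperbolicEightfoldDescent.stub_hyperplaneCalculusSym)
      3 A φ (by norm_num) hA' hφ ⟨c, hc, hrat, hH, hW⟩ eA (g eA.n) haA haA0
  -- 2a: the arithmetic (`Fin (4 * 3)` is `Fin 12` definitionally)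
  obtain ⟨t, b, ht, hsq, hb, hbM, hbΨ, hbG⟩ := stub_splittingArithmetic M G hM2 hGt hGM hPN
  -- 2b: the model of the base change for this `t`
  obtain ⟨e, a', r, Ω, ha', ha'0, hwK, hwF, hQ⟩ :=
    stub_baseChangeModel A φ hA hφ eA (g eA.n) haA haA0 u M G ω d₀ hu_rat hu_ind hu_span hM hG hd₀ t ht
  -- 2c: transport
  refine ⟨t, e, a', ht, hsq, ha', ha'0, ?_⟩
  refine stub_splitFrameTransport (A.prod A) _ _ _ _ (Matrix.fromBlocks M 0 0 M)
    (Matrix.fromBlocks (0 : Matrix (Fin 12) (Fin 12) ℚ) 1 ((t : ℚ) • (1 : Matrix (Fin 12) (Fin 12) ℚ)) 0)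
    (r • Matrix.fromBlocks ((t : ℚ) • G) 0 0 G) Ω ?_ ?_ hwK hwF ?_ b hb hbM hbΨ ?_
  · rintro (i | i)
    · exact (hu_rat i).map _
    · exact (hu_rat i).map _
  · exact linearIndependent_sumElim_map_fst_map_snd hu_ind hu_ind
  · intro k l
    rw [hQ k l, Matrix.smul_apply, smul_eq_mul]
  · intro k l
    rw [sum_mul_smul_matrix_mul, hbG k l, mul_zero]

end Assembly

/-! ### The composition: the stubs imply the crux, by name -/

/-- **`WeilSixfoldsSqrtMinus7` from the stubs** (pure logic plus the PROVED product bookkeeping and the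
PROVED assembly of the splitting; no `sorry` outside the stubs). Given `(A, φ)` and a rational `(3,3)`
class `c` of the Weil plane: if `c = 0` it is algebraic (`0 ∈ N³H⁶`). Otherwise `c` witnesses Weil type,
the splitting (2a–2c via `baseChangeSplitting_of_parts`) gives `(t, e, a)` with the base change
`A ⊗ O_{ℚ(√t)}` of split `L`-Weil type, STUB 3 (fed with `dim_bc`, `psiK_comp_psiK`, `psiF_comp_psiF`,
`psiK_comm_psiF`) one non-zero rational algebraic `L`-Weil class on it, STUB 4 all of them, and STUB 1
descends to the `K`-Weil classes of `A`, in particular `c`. -/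
theorem WeilSixfoldsSqrtMinus7_of (h3 : Registered.stub_splitSecantClass) :
    Summit.HodgeConjecture.HodgeConjecture.Theses.HeckePrymWeil.WeilSixfoldsSqrtMinus7 := by
  intro A φ hdim hφ c hrat hhodge hmem
  by_cases hc : c = 0
  · rw [hc]
    exact Submodule.zero_mem _
  · obtain ⟨t, e, a, ht, hsq, ha, ha0, hsplit⟩ :=
      baseChangeSplitting_of_parts A φ hdim hφ ⟨c, hrat, hhodge, hmem, hc⟩
    have hone := h3 (bc A) (psiK A φ) (psiF A t) t (dim_bc hdim) (psiK_comp_psiK hφ)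
      (psiF_comp_psiF A t) (psiK_comm_psiF A φ t) ht hsq e a ha ha0 hsplit
    have hL := stub_oneClassSuffices (bc A) (psiK A φ) (psiF A t) t (dim_bc hdim) (psiK_comp_psiK hφ)
      (psiF_comp_psiF A t) (psiK_comm_psiF A φ t) ht hsq hone
    exact stub_untwisting A φ hdim hφ t ht hL c hrat hhodge hmem

/-- Wiring check: the registered stubs feed `WeilSixfoldsSqrtMinus7_of` as stated (depends on their
`sorry`s; shows the composition closes). -/
theorem WeilSixfoldsSqrtMinus7_of_stubs :
    Summit.HodgeConjecture.HodgeConjecture.Theses.HeckePrymWeil.WeilSixfoldsSqrtMinus7 :=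
  WeilSixfoldsSqrtMinus7_of stub_splitSecantClass

end Summit.HodgeConjecture.HodgeConjecture.Cruxes.WeilSixfoldsSqrtMinus7.RealQuadraticBaseChange

end
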